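import Literature.Algebra.Homology.BoundedAboveResolution
import Literature.Algebra.Homology.RightDerivedFunctorPlusInjectiveModel
import Literature.AlgebraicGeometry.Modules.SyzygyLocallyFreeOfRegularComplex
import Literature.AlgebraicGeometry.Modules.StrictlyPerfectResolutionOfRegular
import Literature.AlgebraicGeometry.Modules.StrictlyPerfectResolutionOfVBModel
import Literature.AlgebraicGeometry.Modules.HigherDirectImageRestrictOpen
import Literature.AlgebraicGeometry.Modules.QuasicoherentAbelian
import Literature.AlgebraicGeometry.Modules.QuasicoherentEpiDominatedByVectorBundle
import Literature.AlgebraicGeometry.Modules.BoundedCoherentVBModels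
import HarnessLib

/-!
# Bounded vector-bundle models of objects of `D⁺(Mod 𝒪_X)` REPRESENTED by bounded complexes of quasi-coherent /
# coherent modules, on a regular scheme with the resolution property (Thomason–Trobaugh 2.3.1 (d) ∧ regularity)

Stage IV + assembly of the K-phase argument behind the named fact
`Modules/BoundedCoherentVBModels.ThomasonTrobaugh_vbModel_of_boundedCoh` ([SP]): on a locally noetherian scheme `X`
whose local rings are regular of Krull dimension `≤ d`,

* `exists_vbModel_of_qcRepresentative`: if every epimorphism from a quasi-coherent (affine-localizing) module onto a
  coherent module is dominated by a finite locally free module (`hlift`, a HYPOTHESIS — on projective schemes it is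
  Serre's theorem, `Modules/QuasicoherentEpiDominatedByVectorBundle`), then every `E : D⁺(Mod 𝒪_X)` with `E.IsGE a`
  and coherent cohomology sheaves which is the class of a BOUNDED complex of quasi-coherent modules is the class of a
  bounded complex of finite locally free modules (`IsBoundedVBComplex`);
* `exists_vbModel_of_cohRepresentative`: the same for `E` the class of a bounded complex of COHERENT modules, with
  `hlift` replaced by the resolution property `hquot` (every coherent module is a quotient of a finite locally free
  one);
* `AbelianVariety.exists_vbModel_of_cohRepresentative`: on an abelian variety, unconditionally (resolution property,
  regularity and the dimension bound are in the tree).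
* §4 `exists_vbModel_of_qcRepresentative_of_isLE`, `AbelianVariety.exists_vbModel_of_qcRepresentative_of_isLE`: the
  same for a representative bounded BELOW only, the upper bound being put on the cohomology of `E` (`E.IsLE b`); the
  canonical truncation `τ^{≤b}` (Mathlib `CochainComplex.truncLE`) is done inside, and on an abelian variety `hlift` is
  discharged by `Modules/QuasicoherentEpiDominatedByVectorBundle`. What then remains of [SP] is exactly the classical
  comparison `D⁺(QCoh) ≃ D⁺_qc(Mod)` (a bounded-below quasi-coherent representative).

The proof runs the bounded-above resolution `Algebra/Homology/BoundedAboveResolution.exists_quasiIso_of_frontier_kernel`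
(Stage 0), terminates it by the syzygy theorem for complexes
`Modules/SyzygyLocallyFreeOfRegularComplex.isFiniteLocallyFree_kernel_of_exactAt` (Stage III) below the amplitude of
`E` and the support of the representative, and transports the quasi-isomorphism to `D⁺`
(`Functor.isIso_Q_map_of_quasiIso`, `plusHomologyFunctorQObjIso`). What is NOT here (Stage I): that every
`E ∈ D⁺(Mod 𝒪_X)` with (quasi-)coherent bounded cohomology HAS such a representative (`D^b(Coh X) → D^b_coh(Mod 𝒪_X)`
essentially surjective, SGA 6 II 2.2.2.1; `D⁺(QCoh X) ≃ D⁺_qc(Mod 𝒪_X)`, SGA 6 II 3.5 / Thomason–Trobaugh App. B).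
-/

noncomputable section

universe w u

open CategoryTheory CategoryTheory.Limits AlgebraicGeometry HomologicalComplex

namespace Literature.AlgebraicGeometry.Modules

open Literature.AlgebraicGeometry.Morphisms Literature.AlgebraicGeometry.Motives
  Literature.AlgebraicGeometry.KTheory Literature.AlgebraicGeometry.KTheory.Adapted
  Literature.AlgebraicGeometry.Resolution Literature.Algebra.Homology.BoundedAboveResolution

variable {X : Scheme.{u}} [IsLocallyNoetherian X]

/-! ### §1 Closure properties of coherence used by the K-phase -/

omit [IsLocallyNoetherian X] in
/-- A binary biproduct of coherent modules is coherent (split extension; private copy of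
`Morphisms/FormalModuleCompletionAdditive.coh_biprod`, not imported here). [cite: Hartshorne1977, II Prop. 5.7 (p. 114)] -/
private theorem coh_biprod {M N : X.Modules} (hM : Coh M) (hN : Coh N) : Coh (M ⊞ N) :=
  ⟨IsAffineLocalizing.biprod hM.loc hN.loc,
    IsAffineFiniteType.of_shortExact₂ (ShortComplex.Splitting.ofHasBinaryBiproduct M N).shortExact hM.loc hM.ft hN.ft⟩

/-- A pullback of coherent modules is coherent: it is the kernel of `(f, -g) : M ⊞ N → P`.
[cite: Hartshorne1977, II Prop. 5.7 (p. 114)] -/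
theorem coh_limitsPullback {M N P : X.Modules} (f : M ⟶ P) (g : N ⟶ P) (hM : Coh M) (hN : Coh N) (hP : Coh P) :
    Coh (Limits.pullback f g) :=
  coh_of_iso' ((kernelIsKernel (biprod.desc f (-g))).conePointUniqueUpToIso
      (Abelian.PullbackToBiproductIsKernel.isLimitPullbackToBiproduct f g))
    (coh_kernel _ (coh_biprod hM hN) hP)

/-- The cycles `Zⁱ` of a complex of coherent modules are coherent (a kernel). [cite: Hartshorne1977, II Prop. 5.7 (p. 114)] -/
theorem coh_cycles (M : CochainComplex X.Modules ℤ) (hM : ∀ i, Coh (M.X i)) (i : ℤ) : Coh (M.cycles i) :=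
  coh_of_iso' ((M.cyclesIsKernel i (i + 1) (by simp)).conePointUniqueUpToIso (kernelIsKernel (M.d i (i + 1)))).symm
    (coh_kernel _ (hM i) (hM (i + 1)))

/-- The homology sheaves `Hⁱ` of a complex of coherent modules are coherent (a cokernel of `Mⁱ⁻¹ → Zⁱ`).
[cite: Hartshorne1977, II Prop. 5.7 (p. 114)] -/
theorem coh_homology (M : CochainComplex X.Modules ℤ) (hM : ∀ i, Coh (M.X i)) (i : ℤ) : Coh (M.homology i) :=
  coh_of_iso' ((colimit.isColimit _).coconePointUniqueUpToIso (M.homologyIsCokernel (i - 1) i (by simp)))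
    (Coh.cokernel _ (hM (i - 1)) (coh_cycles M hM i))

/-! ### §2 The vector-bundle model of an object represented by a bounded complex of quasi-coherent modules -/

/-- **Thomason–Trobaugh 2.3.1 (d) ∧ regularity modulo the `D⁺_qc` comparison — quasi-coherent representative.** Let
`X` be a locally noetherian scheme whose local rings are regular of Krull dimension `≤ d`, with the LIFTING PROPERTY
`hlift`: every epimorphism from a quasi-coherent (affine-localizing) module onto a coherent module is dominated by a
finite locally free module (on a noetherian scheme with the resolution property this is EGA I 9.4.9 — a coherent
submodule of the source maps onto the target — plus the resolution property; it is a HYPOTHESIS here). Let `E` be an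
object of `D⁺(Mod 𝒪_X)` with `E.IsGE a` and coherent cohomology sheaves which is the class `Q⁺ M` of a BOUNDED complex
`M` of quasi-coherent modules. Then `E` is the class of a bounded complex of finite locally free modules: the K-phase
`Algebra/Homology/BoundedAboveResolution` with `𝒫 ∕ 𝒞 ∕ 𝒜'` := finite locally free ∕ affine-localizing ∕ coherent,
terminated below the amplitude and the support of `M` by the syzygy theorem for complexes
(`Modules/SyzygyLocallyFreeOfRegularComplex.isFiniteLocallyFree_kernel_of_exactAt`), closed, and transported to `D⁺`
(`isIso_Q_map_of_quasiIso`, `plusHomologyFunctorQObjIso`). The canonical truncation of a bounded-BELOW representative to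
a bounded one is left to the provider of the representative (SGA 6 II 3.5 / TT App. B / Stacks 09T4, NOT in the tree).
[cite: ThomasonTrobaugh1990, Prop. 2.3.1 (d)] [cite: SGA6, Exp. II Cor. 2.2.2.1] [cite: GortzWedhorn2023, Prop. 22.58] -/
theorem exists_vbModel_of_qcRepresentative [HasDerivedCategory.{w} X.Modules] {d : ℕ}
    (hreg : Scheme.IsRegular X) (hdim : ∀ x : X, ringKrullDim (X.presheaf.stalk x) ≤ d)
    (hlift : ∀ {M N : X.Modules} (g : M ⟶ N) [Epi g], IsAffineLocalizing M → Coh N →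
      ∃ (F : X.Modules) (p : F ⟶ M), IsFiniteLocallyFree F ∧ Epi (p ≫ g))
    (E : DerivedCategory.Plus X.Modules) (a : ℤ) (hE : E.IsGE a)
    (hcoh : ∀ k : ℤ, Coh ((DerivedCategory.Plus.homologyFunctor _ k).obj E))
    (M : CochainComplex X.Modules ℤ) {n b : ℤ} (hn : M.IsStrictlyGE n) [M.IsStrictlyLE b]
    (hM : ∀ i, IsAffineLocalizing (M.X i)) (eM : DerivedCategory.Plus.Q.obj ⟨M, n, hn⟩ ≅ E) :
    ∃ (K : CochainComplex X.Modules ℤ) (_ : IsBoundedVBComplex K) (m : ℤ) (hm : K.IsStrictlyGE m),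
      Nonempty (DerivedCategory.Plus.Q.obj ⟨K, m, hm⟩ ≅ E) := by
  haveI := hE
  -- the cohomology of `M` is that of `E`: coherent, and zero below `a`
  have eH : ∀ i, (DerivedCategory.Plus.homologyFunctor _ i).obj E ≅ M.homology i := fun i =>
    (DerivedCategory.Plus.homologyFunctor _ i).mapIso eM.symm ≪≫ plusHomologyFunctorQObjIso ⟨M, n, hn⟩ i
  have hMA' : ∀ i, Coh (M.homology i) := fun i => coh_of_iso' (eH i) (hcoh i)
  have hMex : ∀ i, i < a → M.ExactAt i := fun i hi =>
    (M.exactAt_iff_isZero_homology i).2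
      ((DerivedCategory.Plus.isZero_homology_of_isGE E a i hi).of_iso (eH i).symm)
  -- the classes `𝒫 ∕ 𝒞 ∕ 𝒜'` := finite locally free ∕ affine-localizing ∕ coherent
  let P : ObjectProperty X.Modules := fun F => IsFiniteLocallyFree F
  let 𝒞 : ObjectProperty X.Modules := fun F => IsAffineLocalizing F
  let A' : ObjectProperty X.Modules := fun F => Coh F
  haveI hPi : P.IsClosedUnderIsomorphisms := ⟨fun e h => isFiniteLocallyFree_of_iso e h⟩
  haveI h𝒞i : 𝒞.IsClosedUnderIsomorphisms := ⟨fun e h => IsAffineLocalizing.of_iso e h⟩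
  haveI hA'i : A'.IsClosedUnderIsomorphisms := ⟨fun e h => coh_of_iso' e h⟩
  have hPA' : ∀ F, P F → A' F := fun F h => coh_of_isFiniteLocallyFree h
  have hA'𝒞 : ∀ F, A' F → 𝒞 F := fun F h => h.loc
  have hP0 : ∀ F : X.Modules, IsZero F → P F := fun F h => KZero.isFiniteLocallyFree_of_isZero h
  have hPB : ∀ F G : X.Modules, P F → P G → P (F ⊞ G) := fun F G hF hG => KZero.isFiniteLocallyFree_biprod hF hG
  have hA'ker : ∀ {F G : X.Modules} (f : F ⟶ G), A' F → A' G → A' (kernel f) := fun f hF hG => coh_kernel f hF hG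
  have h𝒞ker : ∀ {F G : X.Modules} (f : F ⟶ G), 𝒞 F → 𝒞 G → 𝒞 (kernel f) :=
    fun f hF hG => IsAffineLocalizing.kernel f hF hG
  have h𝒞pb : ∀ {F G H : X.Modules} (f : F ⟶ H) (g : G ⟶ H), 𝒞 F → 𝒞 G → 𝒞 H → 𝒞 (pullback f g) :=
    fun f g hF hG hH => IsAffineLocalizing.of_iso
      ((kernelIsKernel (biprod.desc f (-g))).conePointUniqueUpToIso
        (Abelian.PullbackToBiproductIsKernel.isLimitPullbackToBiproduct f g))
      (IsAffineLocalizing.kernel _ (IsAffineLocalizing.biprod hF hG) hH)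
  -- the frontier, below the amplitude of `E` and the support of `M`
  let f : ℤ := min n (min a (b + 1)) - d - 2
  have hterm : ∀ (L : CochainComplex X.Modules ℤ) (φ : L ⟶ M), (∀ i, P (L.X i)) → L.IsStrictlyLE b →
      (∀ i, i < f → IsZero (L.X i)) → (∀ i, f < i → QuasiIsoAt φ i) → P (kernel (L.d f (f + 1))) := by
    intro L φ hP _ _ hq
    refine isFiniteLocallyFree_kernel_of_exactAt hreg hdim L hP (m := a) (f := f)
      (fun i hi hi' => ?_) (by omega) (by omega)
    haveI := hq i hi
    exact (quasiIsoAt_iff_exactAt' φ i (hMex i hi')).1 inferInstance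
  obtain ⟨L, φ, hP, hLE, hz, hqi⟩ :=
    @exists_quasiIso_of_frontier_kernel _ _ _ P 𝒞 A' hPi h𝒞i hA'i hPA' hA'𝒞 hP0 hPB
      (fun f hF hG => hA'ker f hF hG) (fun f hF hG => h𝒞ker f hF hG) (fun f g hF hG hH => h𝒞pb f g hF hG hH)
      (fun g _ hF hG => hlift g hF hG) M b inferInstance hM hMA' f (by omega)
      (fun i hi => M.isZero_of_isStrictlyGE n i (by omega)) hterm
  haveI := hLE
  haveI := hqi
  -- the bounded VB complex and its class in `D⁺`
  have hK : IsBoundedVBComplex L :=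
    ⟨hP, ⟨Finset.Icc (f - 1) b, fun i hi => by
      rcases lt_or_ge i (f - 1) with h | h
      · exact hz i h
      · exact L.isZero_of_isStrictlyLE b i (by
          simp only [Finset.mem_Icc, not_and, not_le] at hi
          exact hi h)⟩⟩
  have hm : L.IsStrictlyGE (f - 1) := by
    rw [CochainComplex.isStrictlyGE_iff]
    intro i hi
    exact hz i hi
  let φ' : (⟨L, f - 1, hm⟩ : CochainComplex.Plus X.Modules) ⟶ ⟨M, n, hn⟩ := ObjectProperty.homMk φ
  haveI : QuasiIso φ'.hom := hqi
  haveI := Functor.isIso_Q_map_of_quasiIso (C := X.Modules) φ'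
  exact ⟨L, hK, f - 1, hm, ⟨asIso (DerivedCategory.Plus.Q.map φ') ≪≫ eM⟩⟩

/-! ### §3 The vector-bundle model of an object represented by a bounded complex of COHERENT modules (no lifting hypothesis) -/

/-- **Thomason–Trobaugh 2.3.1 (d) ∧ regularity, for objects REPRESENTED by a bounded complex of coherent modules.** Let
`X` be a locally noetherian scheme with the resolution property (`hquot`: every coherent module is a quotient of a finite
locally free one) whose local rings are regular of Krull dimension `≤ d`. Let `E` be an object of `D⁺(Mod 𝒪_X)` with
`E.IsGE a` which is the class `Q⁺ M` of a BOUNDED complex `M` of COHERENT modules. Then `E` is the class of a bounded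
complex of finite locally free modules. Proof: the K-phase `Algebra/Homology/BoundedAboveResolution` with
`𝒫 ∕ 𝒞 ∕ 𝒜'` := finite locally free ∕ coherent ∕ coherent (lifting property = the resolution property), terminated
below the amplitude and the support of `M` by the syzygy theorem for complexes
(`Modules/SyzygyLocallyFreeOfRegularComplex.isFiniteLocallyFree_kernel_of_exactAt`), closed, and transported to `D⁺`
(`isIso_Q_map_of_quasiIso`, `plusHomologyFunctorQObjIso`). With the essential surjectivity
`D^b(Coh X) → D^b_coh(Mod 𝒪_X)` (SGA 6 II 2.2.2.1 — NOT in the tree) this is, on a complex abelian variety, the named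
fact `Modules/BoundedCoherentVBModels.ThomasonTrobaugh_vbModel_of_boundedCoh`.
[cite: ThomasonTrobaugh1990, Prop. 2.3.1 (d)] [cite: SGA6, Exp. II Cor. 2.2.2.1] [cite: GortzWedhorn2023, Prop. 22.58] -/
theorem exists_vbModel_of_cohRepresentative [HasDerivedCategory.{w} X.Modules] {d : ℕ}
    (hreg : Scheme.IsRegular X) (hdim : ∀ x : X, ringKrullDim (X.presheaf.stalk x) ≤ d)
    (hquot : ∀ G : X.Modules, Coh G → ∃ (F : X.Modules) (p : F ⟶ G), IsFiniteLocallyFree F ∧ Epi p)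
    (E : DerivedCategory.Plus X.Modules) (a : ℤ) (hE : E.IsGE a)
    (M : CochainComplex X.Modules ℤ) {n b : ℤ} (hn : M.IsStrictlyGE n) [M.IsStrictlyLE b]
    (hM : ∀ i, Coh (M.X i)) (eM : DerivedCategory.Plus.Q.obj ⟨M, n, hn⟩ ≅ E) :
    ∃ (K : CochainComplex X.Modules ℤ) (_ : IsBoundedVBComplex K) (m : ℤ) (hm : K.IsStrictlyGE m),
      Nonempty (DerivedCategory.Plus.Q.obj ⟨K, m, hm⟩ ≅ E) := by
  haveI := hE
  -- the cohomology of `M` is that of `E`: zero below `a`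
  have eH : ∀ i, (DerivedCategory.Plus.homologyFunctor _ i).obj E ≅ M.homology i := fun i =>
    (DerivedCategory.Plus.homologyFunctor _ i).mapIso eM.symm ≪≫ plusHomologyFunctorQObjIso ⟨M, n, hn⟩ i
  have hMex : ∀ i, i < a → M.ExactAt i := fun i hi =>
    (M.exactAt_iff_isZero_homology i).2
      ((DerivedCategory.Plus.isZero_homology_of_isGE E a i hi).of_iso (eH i).symm)
  -- the classes `𝒫 ∕ 𝒞 = 𝒜'` := finite locally free ∕ coherent
  let P : ObjectProperty X.Modules := fun F => IsFiniteLocallyFree F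
  let A' : ObjectProperty X.Modules := fun F => Coh F
  haveI hPi : P.IsClosedUnderIsomorphisms := ⟨fun e h => isFiniteLocallyFree_of_iso e h⟩
  haveI hA'i : A'.IsClosedUnderIsomorphisms := ⟨fun e h => coh_of_iso' e h⟩
  have hPA' : ∀ F, P F → A' F := fun F h => coh_of_isFiniteLocallyFree h
  have hP0 : ∀ F : X.Modules, IsZero F → P F := fun F h => KZero.isFiniteLocallyFree_of_isZero h
  have hPB : ∀ F G : X.Modules, P F → P G → P (F ⊞ G) := fun F G hF hG => KZero.isFiniteLocallyFree_biprod hF hG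
  have hA'ker : ∀ {F G : X.Modules} (f : F ⟶ G), A' F → A' G → A' (kernel f) := fun f hF hG => coh_kernel f hF hG
  have hA'pb : ∀ {F G H : X.Modules} (f : F ⟶ H) (g : G ⟶ H), A' F → A' G → A' H → A' (pullback f g) :=
    fun f g hF hG hH => coh_limitsPullback f g hF hG hH
  have hlift : ∀ {F G : X.Modules} (g : F ⟶ G) [Epi g], A' F → A' G →
      ∃ (L : X.Modules) (p : L ⟶ F), P L ∧ Epi (p ≫ g) := by
    intro F G g _ hF _
    obtain ⟨L, p, hL, hp⟩ := hquot F hF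
    exact ⟨L, p, hL, epi_comp _ _⟩
  -- the frontier, below the amplitude of `E` and the support of `M`
  let f : ℤ := min n (min a (b + 1)) - d - 2
  have hterm : ∀ (L : CochainComplex X.Modules ℤ) (φ : L ⟶ M), (∀ i, P (L.X i)) → L.IsStrictlyLE b →
      (∀ i, i < f → IsZero (L.X i)) → (∀ i, f < i → QuasiIsoAt φ i) → P (kernel (L.d f (f + 1))) := by
    intro L φ hP _ _ hq
    refine isFiniteLocallyFree_kernel_of_exactAt hreg hdim L hP (m := a) (f := f)
      (fun i hi hi' => ?_) (by omega) (by omega)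
    haveI := hq i hi
    exact (quasiIsoAt_iff_exactAt' φ i (hMex i hi')).1 inferInstance
  obtain ⟨L, φ, hP, hLE, hz, hqi⟩ :=
    @exists_quasiIso_of_frontier_kernel _ _ _ P A' A' hPi hA'i hA'i hPA' (fun _ h => h) hP0 hPB
      (fun f hF hG => hA'ker f hF hG) (fun f hF hG => hA'ker f hF hG) (fun f g hF hG hH => hA'pb f g hF hG hH)
      (fun g _ hF hG => hlift g hF hG) M b inferInstance hM (coh_homology M hM) f (by omega)
      (fun i hi => M.isZero_of_isStrictlyGE n i (by omega)) hterm
  haveI := hLE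
  haveI := hqi
  -- the bounded VB complex and its class in `D⁺`
  have hK : IsBoundedVBComplex L :=
    ⟨hP, ⟨Finset.Icc (f - 1) b, fun i hi => by
      rcases lt_or_ge i (f - 1) with h | h
      · exact hz i h
      · exact L.isZero_of_isStrictlyLE b i (by
          simp only [Finset.mem_Icc, not_and, not_le] at hi
          exact hi h)⟩⟩
  have hm : L.IsStrictlyGE (f - 1) := by
    rw [CochainComplex.isStrictlyGE_iff]
    intro i hi
    exact hz i hi
  let φ' : (⟨L, f - 1, hm⟩ : CochainComplex.Plus X.Modules) ⟶ ⟨M, n, hn⟩ := ObjectProperty.homMk φ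
  haveI : QuasiIso φ'.hom := hqi
  haveI := Functor.isIso_Q_map_of_quasiIso (C := X.Modules) φ'
  exact ⟨L, hK, f - 1, hm, ⟨asIso (DerivedCategory.Plus.Q.map φ') ≪≫ eM⟩⟩

/-- **On an abelian variety, every object of `D⁺(Mod 𝒪_B)` represented by a bounded complex of coherent modules is the
class of a bounded vector-bundle complex** — unconditionally: the resolution property
(`Modules/ResolutionPropertyProjective.AbelianVariety.exists_isFiniteLocallyFree_epi_of_coh`), regularity and the stalk
dimension bound (`Modules/StrictlyPerfectResolutionOfRegular.AbelianVariety.isRegular`, `….ringKrullDim_stalk_le_dim`)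
feed `exists_vbModel_of_cohRepresentative`. This is the tree's named fact [SP]
`ThomasonTrobaugh_vbModel_of_boundedCoh` for all `E` in the essential image of `D^b(Coh B)`; the missing input for
[SP] itself is exactly SGA 6 II 2.2.2.1 (`D^b(Coh B) → D^b_coh(Mod 𝒪_B)` essentially surjective).
[cite: ThomasonTrobaugh1990, Prop. 2.3.1 (d)] [cite: SGA6, Exp. II Cor. 2.2.2.1] -/
theorem AbelianVariety.exists_vbModel_of_cohRepresentative {k : Type u} [Field k] (B : AbelianVariety k)
    [HasDerivedCategory.{w} B.X.left.Modules] (E : DerivedCategory.Plus B.X.left.Modules) (a : ℤ) (hE : E.IsGE a)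
    (M : CochainComplex B.X.left.Modules ℤ) {n b : ℤ} (hn : M.IsStrictlyGE n) [M.IsStrictlyLE b]
    (hM : ∀ i, Coh (M.X i)) (eM : DerivedCategory.Plus.Q.obj ⟨M, n, hn⟩ ≅ E) :
    ∃ (K : CochainComplex B.X.left.Modules ℤ) (_ : IsBoundedVBComplex K) (m : ℤ) (hm : K.IsStrictlyGE m),
      Nonempty (DerivedCategory.Plus.Q.obj ⟨K, m, hm⟩ ≅ E) := by
  haveI : IsLocallyNoetherian B.X.left := LocallyOfFiniteType.isLocallyNoetherian B.X.hom
  exact Literature.AlgebraicGeometry.Modules.exists_vbModel_of_cohRepresentative (b := b) (AbelianVariety.isRegular B)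
    (AbelianVariety.ringKrullDim_stalk_le_dim B)
    (fun G hG => AbelianVariety.exists_isFiniteLocallyFree_epi_of_coh B hG) E a hE M hn hM eM

/-! ### §4 Bounded-BELOW quasi-coherent representatives: the canonical truncation `τ^{≤b}` done inside -/

omit [IsLocallyNoetherian X] in
/-- The terms of the canonical truncation `τ^{≤b} M = (⋯ → Mᵇ⁻¹ → Zᵇ(M) → 0)` of a complex of affine-localizing
(quasi-coherent) modules are affine-localizing: `Mⁱ` for `i < b` (Mathlib `CochainComplex.truncLEXIso`), the kernel
`Zᵇ(M) = ker dᵇ` in degree `b` (`CochainComplex.truncLEXIsoCycles`, `IsAffineLocalizing.kernel`), and `0` above `b`.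
[cite: StacksProject, Tag 0118 (canonical truncations)] [cite: Hartshorne1977, II Prop. 5.7 (p. 114)] -/
theorem isAffineLocalizing_truncLE_X (M : CochainComplex X.Modules ℤ) (hM : ∀ i, IsAffineLocalizing (M.X i))
    (b i : ℤ) : IsAffineLocalizing ((M.truncLE b).X i) := by
  rcases lt_trichotomy i b with h | rfl | h
  · exact IsAffineLocalizing.of_iso (M.truncLEXIso b i h).symm (hM i)
  · exact IsAffineLocalizing.of_iso
      ((kernelIsKernel (M.d i (i + 1))).conePointUniqueUpToIso (M.cyclesIsKernel i (i + 1) (by simp)) ≪≫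
        (M.truncLEXIsoCycles i).symm)
      (IsAffineLocalizing.kernel _ (hM i) (hM (i + 1)))
  · exact IsAffineLocalizing.of_isZero ((M.truncLE b).isZero_of_isStrictlyLE b i h)

/-- The terms of the canonical truncation `τ^{≤b} M` of a complex of coherent modules on a locally noetherian scheme
are coherent (`Mⁱ`, `Zᵇ(M)`, `0`; `coh_cycles`). [cite: StacksProject, Tag 0118 (canonical truncations)]
[cite: Hartshorne1977, II Prop. 5.7 (p. 114)] -/
theorem coh_truncLE_X (M : CochainComplex X.Modules ℤ) (hM : ∀ i, Coh (M.X i)) (b i : ℤ) : Coh ((M.truncLE b).X i) := by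
  rcases lt_trichotomy i b with h | rfl | h
  · exact coh_of_iso' (M.truncLEXIso b i h).symm (hM i)
  · exact coh_of_iso' (M.truncLEXIsoCycles i).symm (coh_cycles M hM i)
  · exact coh_of_isZero' ((M.truncLE b).isZero_of_isStrictlyLE b i h)

omit [IsLocallyNoetherian X] in
/-- `τ^{≤b}` preserves strict lower bounds: if `Mⁱ = 0` for all `i < n`, then `(τ^{≤b} M)ⁱ = 0` for all `i < n`
(its terms are `Mⁱ`, the subobject `Zᵇ(M) ↪ Mᵇ`, or `0`). [cite: StacksProject, Tag 0118 (canonical truncations)] -/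
theorem isStrictlyGE_truncLE (M : CochainComplex X.Modules ℤ) (n b : ℤ) [M.IsStrictlyGE n] :
    (M.truncLE b).IsStrictlyGE n := by
  rw [CochainComplex.isStrictlyGE_iff]
  intro i hi
  rcases lt_trichotomy i b with h | rfl | h
  · exact (M.isZero_of_isStrictlyGE n i hi).of_iso (M.truncLEXIso b i h)
  · exact (IsZero.of_mono (M.iCycles i) (M.isZero_of_isStrictlyGE n i hi)).of_iso (M.truncLEXIsoCycles i)
  · exact (M.truncLE b).isZero_of_isStrictlyLE b i h

/-- **Thomason–Trobaugh 2.3.1 (d) ∧ regularity for BOUNDED-BELOW quasi-coherent representatives.** As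
`exists_vbModel_of_qcRepresentative`, but the quasi-coherent representative `M` of `E` is only assumed bounded BELOW
(`M.IsStrictlyGE n`, the natural output of the comparison `D⁺(QCoh X) → D⁺(Mod 𝒪_X)`), the upper bound being put on
the COHOMOLOGY of `E` (`E.IsLE b`). Proof: the canonical truncation `τ^{≤b} M` (Mathlib `CochainComplex.truncLE`) has
affine-localizing terms (`isAffineLocalizing_truncLE_X`), is strictly bounded (`isStrictlyGE_truncLE`, Mathlib's
`IsStrictlyLE` instance), and `τ^{≤b} M → M` is a quasi-isomorphism since `M` is cohomologically `≤ b`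
(`CochainComplex.quasiIso_ιTruncLE_iff`; the cohomology of `M` is that of `E`, `plusHomologyFunctorQObjIso`), hence
an isomorphism in `D⁺` (`Functor.isIso_Q_map_of_quasiIso`); then `exists_vbModel_of_qcRepresentative` applies. So
the only input of [SP] `ThomasonTrobaugh_vbModel_of_boundedCoh` not supplied by this file and
`Modules/QuasicoherentEpiDominatedByVectorBundle` is the classical comparison «every `E ∈ D⁺(Mod 𝒪_X)` with
quasi-coherent cohomology is `Q⁺` of a bounded-below complex of quasi-coherent modules» (SGA 6 II 3.5,
Thomason–Trobaugh App. B, Stacks 09T4 — NOT in the tree).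
[cite: ThomasonTrobaugh1990, Prop. 2.3.1 (d) and Appendix B] [cite: SGA6, Exp. II Prop. 3.5 and Cor. 2.2.2.1]
[cite: StacksProject, Tag 09T4] -/
theorem exists_vbModel_of_qcRepresentative_of_isLE [HasDerivedCategory.{w} X.Modules] {d : ℕ}
    (hreg : Scheme.IsRegular X) (hdim : ∀ x : X, ringKrullDim (X.presheaf.stalk x) ≤ d)
    (hlift : ∀ {M N : X.Modules} (g : M ⟶ N) [Epi g], IsAffineLocalizing M → Coh N →
      ∃ (F : X.Modules) (p : F ⟶ M), IsFiniteLocallyFree F ∧ Epi (p ≫ g))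
    (E : DerivedCategory.Plus X.Modules) (a b : ℤ) (hE : E.IsGE a) (hb : E.IsLE b)
    (hcoh : ∀ k : ℤ, Coh ((DerivedCategory.Plus.homologyFunctor _ k).obj E))
    (M : CochainComplex X.Modules ℤ) {n : ℤ} (hn : M.IsStrictlyGE n)
    (hM : ∀ i, IsAffineLocalizing (M.X i)) (eM : DerivedCategory.Plus.Q.obj ⟨M, n, hn⟩ ≅ E) :
    ∃ (K : CochainComplex X.Modules ℤ) (_ : IsBoundedVBComplex K) (m : ℤ) (hm : K.IsStrictlyGE m),
      Nonempty (DerivedCategory.Plus.Q.obj ⟨K, m, hm⟩ ≅ E) := by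
  haveI := hb
  haveI := hn
  -- the cohomology of `M` is that of `E`: `M` is cohomologically `≤ b`
  have eH : ∀ i, (DerivedCategory.Plus.homologyFunctor _ i).obj E ≅ M.homology i := fun i =>
    (DerivedCategory.Plus.homologyFunctor _ i).mapIso eM.symm ≪≫ plusHomologyFunctorQObjIso ⟨M, n, hn⟩ i
  haveI : M.IsLE b := by
    rw [CochainComplex.isLE_iff]
    intro i hi
    exact (M.exactAt_iff_isZero_homology i).2
      ((DerivedCategory.Plus.isZero_homology_of_isLE E b i hi).of_iso (eH i).symm)
  -- the truncation `τ^{≤b} M`, a bounded quasi-coherent representative of `E`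
  haveI hn' : (M.truncLE b).IsStrictlyGE n := isStrictlyGE_truncLE M n b
  let ι' : (⟨M.truncLE b, n, hn'⟩ : CochainComplex.Plus X.Modules) ⟶ ⟨M, n, hn⟩ :=
    ObjectProperty.homMk (M.ιTruncLE b)
  haveI : QuasiIso ι'.hom := inferInstanceAs (QuasiIso (M.ιTruncLE b))
  haveI := Functor.isIso_Q_map_of_quasiIso (C := X.Modules) ι'
  exact exists_vbModel_of_qcRepresentative (b := b) hreg hdim hlift E a hE hcoh (M.truncLE b) hn'
    (isAffineLocalizing_truncLE_X M hM b) (asIso (DerivedCategory.Plus.Q.map ι') ≪≫ eM)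

/-- **On an abelian variety: every `E ∈ D⁺(Mod 𝒪_B)` with bounded coherent cohomology which is the class of a
bounded-below complex of quasi-coherent modules is the class of a bounded vector-bundle complex** — unconditionally:
regularity and the dimension bound (`Modules/StrictlyPerfectResolutionOfRegular.AbelianVariety.isRegular`,
`….ringKrullDim_stalk_le_dim`) and the lifting property
(`Modules/QuasicoherentEpiDominatedByVectorBundle.AbelianVariety.exists_isFiniteLocallyFree_epi_comp`, Serre) feed
`exists_vbModel_of_qcRepresentative_of_isLE`. This is the tree's named fact [SP] `ThomasonTrobaugh_vbModel_of_boundedCoh`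
for every `E` in the essential image of `Q⁺ : C⁺(QCoh B) → D⁺(Mod 𝒪_B)`; [SP] as typed follows from it and the
classical comparison `D⁺(QCoh B) ≃ D⁺_qc(Mod 𝒪_B)` (SGA 6 II 3.5 / Thomason–Trobaugh App. B / Stacks 09T4, NOT in the
tree). [cite: ThomasonTrobaugh1990, Prop. 2.3.1 (d) and Appendix B] [cite: SGA6, Exp. II Prop. 3.5]
[cite: MumfordAV1970, §6 Application 1 (p. 62)] -/
theorem AbelianVariety.exists_vbModel_of_qcRepresentative_of_isLE {k : Type u} [Field k] (B : AbelianVariety k)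
    [HasDerivedCategory.{w} B.X.left.Modules] (E : DerivedCategory.Plus B.X.left.Modules) (a b : ℤ) (hE : E.IsGE a)
    (hb : E.IsLE b) (hcoh : ∀ i : ℤ, Coh ((DerivedCategory.Plus.homologyFunctor _ i).obj E))
    (M : CochainComplex B.X.left.Modules ℤ) {n : ℤ} (hn : M.IsStrictlyGE n)
    (hM : ∀ i, IsAffineLocalizing (M.X i)) (eM : DerivedCategory.Plus.Q.obj ⟨M, n, hn⟩ ≅ E) :
    ∃ (K : CochainComplex B.X.left.Modules ℤ) (_ : IsBoundedVBComplex K) (m : ℤ) (hm : K.IsStrictlyGE m),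
      Nonempty (DerivedCategory.Plus.Q.obj ⟨K, m, hm⟩ ≅ E) := by
  haveI : IsLocallyNoetherian B.X.left := LocallyOfFiniteType.isLocallyNoetherian B.X.hom
  exact Literature.AlgebraicGeometry.Modules.exists_vbModel_of_qcRepresentative_of_isLE (AbelianVariety.isRegular B)
    (AbelianVariety.ringKrullDim_stalk_le_dim B)
    (fun g _ hF hG => AbelianVariety.exists_isFiniteLocallyFree_epi_comp B g hF hG) E a b hE hb hcoh M hn hM eM

end Literature.AlgebraicGeometry.Modules

end
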